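import Summits.CriticalPhenomena.PercolationContinuityZ3.Theorems.PercNearOneGluingNoHeavyLowerTailQ44PortGluing
import Summits.CriticalPhenomena.PercolationContinuityZ3.Theorems.PercNearOneGluingNoHeavyLowerTailQ44SeparatorTools
import HarnessLib

/-!
# Conjecture W (row `Q44`, all `n`) when a TERMINAL is a cut vertex separating another terminal from the remaining two

Support file for crux `stmt-CriticalPhenomena-4575` (Conjecture W = row `Q44` ∀n), seat `prim-l12-p6` gen 28; memo
`run/shared/lean/prim/prim-l12/FROM-prim-l12-p6-g28-PORT-GLUING-LEAN.md` §0 (8) (THEOREM E).  Corollary of the three-port gluing theorem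
`ConjWPort.q44_cells_of_portSplit_core` (`…Q44PortGluing`): if the terminal `b` (resp. `c`, `y`) separates `a` from the other two terminals, the side of
`a` is a three-port side with a single port; there the other two terminals are isolated, the side has only the two cells "all separate" and "`a` joined to
the port", and the four CORE forms (W and the pencils `X_cy, X_by, X_bc`) vanish identically — so the glued weighting satisfies Conjecture W whatever lies
beyond the port.  By the Klein symmetry of W the same holds with the roles of the terminals permuted (not restated).
* `ConjWPort.q44_cells_of_cutTerminal_b`, `…_c`, `…_y` — THEOREM E.
No definitions, no named facts, no sorries, standard axioms.
-/

noncomputable section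

namespace Summit.CriticalPhenomena.PercolationContinuityZ3.Theorems

namespace ConjWPort

open MeasureTheory Set Literature.Probability.LatticeModels Literature.Probability.Percolation
open FourPointAtoms FourPointPort
open Summit.CriticalPhenomena.PercolationContinuityZ3.Cruxes.AdditiveGluing.TieLine.ConnAtoms
open scoped Classical

variable {n : ℕ}

set_option linter.unusedSimpArgs false in
/-- **Conjecture W when the terminal `b` separates `a` from the other two terminals** (`b, c, y` distinct): if `S ∋ a` avoids `b, c, y` and every
pair of positive weight leaving `S` ends at `b`, then `w` satisfies Conjecture W: the side of `a` has the single port `b`, the other two terminals are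
isolated there, its only cells are `0` and `6`, and all four CORE forms of the side vanish (`ConjWPort.q44_cells_of_portSplit_core`). [this work] -/
theorem q44_cells_of_cutTerminal_b (w : Sym2 (Fin n) → unitInterval) (a b c y : Fin n) (hbc : b ≠ c) (hby : b ≠ y) (hcy : c ≠ y)
    (S : Finset (Fin n)) (haS : a ∈ S) (hbS : b ∉ S) (hcS : c ∉ S) (hyS : y ∉ S)
    (hS : ∀ u ∈ S, ∀ v, v ∉ S → v ≠ b → w s(u, v) = 0) :
    2 * (cell w a b c y 11 * cell w a b c y 9 + cell w a b c y 11 * cell w a b c y 8 + cell w a b c y 6 * cell w a b c y 8 +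
        cell w a b c y 6 * cell w a b c y 1 + cell w a b c y 1 * cell w a b c y 8) +
        (cell w a b c y 2 * cell w a b c y 13 + cell w a b c y 1 * cell w a b c y 13 + cell w a b c y 5 * cell w a b c y 12 +
        cell w a b c y 1 * cell w a b c y 12 + cell w a b c y 6 * cell w a b c y 10 + cell w a b c y 6 * cell w a b c y 7 +
          cell w a b c y 2 * cell w a b c y 10 + cell w a b c y 5 * cell w a b c y 7) ≤
      2 * ((cell w a b c y 11 + cell w a b c y 14) * cell w a b c y 0) := by
  set w₁ : Sym2 (Fin n) → unitInterval := fun e => if (∃ u ∈ S, u ∈ e) then w e else 0 with hw₁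
  have h := IsPortSplit.of_side w a b c y S haS hbS hcS hyS (fun u hu v hv hvb hvc hvy => hS u hu v hv hvb)
    w₁ (fun e => if (∃ u ∈ S, u ∈ e) then 0 else w e) (fun _ => rfl) (fun _ => rfl)
  have star_c : ∀ u, u ≠ c → (w₁ s(c, u) : ℝ) = 0 := fun u _ => by
    have hz : w₁ s(c, u) = 0 := by
      simp only [hw₁]
      split_ifs with hex
      · obtain ⟨u', hu'S, hu'e⟩ := hex
        rcases Sym2.mem_iff.1 hu'e with h' | h'
        · exact absurd hu'S (h' ▸ hcS)
        · subst h'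
          rw [Sym2.eq_swap]
          exact hS u' hu'S c hcS hbc.symm
      · rfl
    rw [hz]; rfl
  have star_y : ∀ u, u ≠ y → (w₁ s(y, u) : ℝ) = 0 := fun u _ => by
    have hz : w₁ s(y, u) = 0 := by
      simp only [hw₁]
      split_ifs with hex
      · obtain ⟨u', hu'S, hu'e⟩ := hex
        rcases Sym2.mem_iff.1 hu'e with h' | h'
        · exact absurd hu'S (h' ▸ hyS)
        · subst h'
          rw [Sym2.eq_swap]
          exact hS u' hu'S y hyS hby.symm
      · rfl
    rw [hz]; rfl
  have z1 : cell w₁ a b c y 1 = 0 := cell_eq_zero_of_absent w₁ a b c y 1 2 3 hcy (by decide) star_c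
  have z2 : cell w₁ a b c y 2 = 0 := cell_eq_zero_of_absent w₁ a b c y 2 3 1 hby.symm (by decide) star_y
  have z3 : cell w₁ a b c y 3 = 0 := cell_eq_zero_of_absent w₁ a b c y 3 2 1 hbc.symm (by decide) star_c
  have z4 : cell w₁ a b c y 4 = 0 := cell_eq_zero_of_absent w₁ a b c y 4 3 0 h.ne_y.symm (by decide) star_y
  have z5 : cell w₁ a b c y 5 = 0 := cell_eq_zero_of_absent w₁ a b c y 5 2 0 h.ne_c.symm (by decide) star_c
  have z7 : cell w₁ a b c y 7 = 0 := cell_eq_zero_of_absent w₁ a b c y 7 2 1 hbc.symm (by decide) star_c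
  have z8 : cell w₁ a b c y 8 = 0 := cell_eq_zero_of_absent w₁ a b c y 8 2 1 hbc.symm (by decide) star_c
  have z9 : cell w₁ a b c y 9 = 0 := cell_eq_zero_of_absent w₁ a b c y 9 2 0 h.ne_c.symm (by decide) star_c
  have z10 : cell w₁ a b c y 10 = 0 := cell_eq_zero_of_absent w₁ a b c y 10 2 0 h.ne_c.symm (by decide) star_c
  have z11 : cell w₁ a b c y 11 = 0 := cell_eq_zero_of_absent w₁ a b c y 11 2 3 hcy (by decide) star_c
  have z12 : cell w₁ a b c y 12 = 0 := cell_eq_zero_of_absent w₁ a b c y 12 3 0 h.ne_y.symm (by decide) star_y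
  have z13 : cell w₁ a b c y 13 = 0 := cell_eq_zero_of_absent w₁ a b c y 13 2 0 h.ne_c.symm (by decide) star_c
  have z14 : cell w₁ a b c y 14 = 0 := cell_eq_zero_of_absent w₁ a b c y 14 2 0 h.ne_c.symm (by decide) star_c
  refine q44_cells_of_portSplit_core h ?_ ?_ ?_ ?_ <;> simp only [z1, z2, z3, z4, z5, z7, z8, z9, z10, z11, z12, z13, z14, mul_zero, zero_mul, add_zero, zero_add, sub_zero] <;>
    norm_num

set_option linter.unusedSimpArgs false in
/-- **Conjecture W when the terminal `c` separates `a` from the other two terminals** (`b, c, y` distinct): if `S ∋ a` avoids `b, c, y` and every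
pair of positive weight leaving `S` ends at `c`, then `w` satisfies Conjecture W: the side of `a` has the single port `c`, the other two terminals are
isolated there, its only cells are `0` and `5`, and all four CORE forms of the side vanish (`ConjWPort.q44_cells_of_portSplit_core`). [this work] -/
theorem q44_cells_of_cutTerminal_c (w : Sym2 (Fin n) → unitInterval) (a b c y : Fin n) (hbc : b ≠ c) (hby : b ≠ y) (hcy : c ≠ y)
    (S : Finset (Fin n)) (haS : a ∈ S) (hbS : b ∉ S) (hcS : c ∉ S) (hyS : y ∉ S)
    (hS : ∀ u ∈ S, ∀ v, v ∉ S → v ≠ c → w s(u, v) = 0) :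
    2 * (cell w a b c y 11 * cell w a b c y 9 + cell w a b c y 11 * cell w a b c y 8 + cell w a b c y 6 * cell w a b c y 8 +
        cell w a b c y 6 * cell w a b c y 1 + cell w a b c y 1 * cell w a b c y 8) +
        (cell w a b c y 2 * cell w a b c y 13 + cell w a b c y 1 * cell w a b c y 13 + cell w a b c y 5 * cell w a b c y 12 +
        cell w a b c y 1 * cell w a b c y 12 + cell w a b c y 6 * cell w a b c y 10 + cell w a b c y 6 * cell w a b c y 7 +
          cell w a b c y 2 * cell w a b c y 10 + cell w a b c y 5 * cell w a b c y 7) ≤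
      2 * ((cell w a b c y 11 + cell w a b c y 14) * cell w a b c y 0) := by
  set w₁ : Sym2 (Fin n) → unitInterval := fun e => if (∃ u ∈ S, u ∈ e) then w e else 0 with hw₁
  have h := IsPortSplit.of_side w a b c y S haS hbS hcS hyS (fun u hu v hv hvb hvc hvy => hS u hu v hv hvc)
    w₁ (fun e => if (∃ u ∈ S, u ∈ e) then 0 else w e) (fun _ => rfl) (fun _ => rfl)
  have star_b : ∀ u, u ≠ b → (w₁ s(b, u) : ℝ) = 0 := fun u _ => by
    have hz : w₁ s(b, u) = 0 := by
      simp only [hw₁]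
      split_ifs with hex
      · obtain ⟨u', hu'S, hu'e⟩ := hex
        rcases Sym2.mem_iff.1 hu'e with h' | h'
        · exact absurd hu'S (h' ▸ hbS)
        · subst h'
          rw [Sym2.eq_swap]
          exact hS u' hu'S b hbS hbc
      · rfl
    rw [hz]; rfl
  have star_y : ∀ u, u ≠ y → (w₁ s(y, u) : ℝ) = 0 := fun u _ => by
    have hz : w₁ s(y, u) = 0 := by
      simp only [hw₁]
      split_ifs with hex
      · obtain ⟨u', hu'S, hu'e⟩ := hex
        rcases Sym2.mem_iff.1 hu'e with h' | h'
        · exact absurd hu'S (h' ▸ hyS)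
        · subst h'
          rw [Sym2.eq_swap]
          exact hS u' hu'S y hyS hcy.symm
      · rfl
    rw [hz]; rfl
  have z1 : cell w₁ a b c y 1 = 0 := cell_eq_zero_of_absent w₁ a b c y 1 3 2 hcy.symm (by decide) star_y
  have z2 : cell w₁ a b c y 2 = 0 := cell_eq_zero_of_absent w₁ a b c y 2 1 3 hby (by decide) star_b
  have z3 : cell w₁ a b c y 3 = 0 := cell_eq_zero_of_absent w₁ a b c y 3 1 2 hbc (by decide) star_b
  have z4 : cell w₁ a b c y 4 = 0 := cell_eq_zero_of_absent w₁ a b c y 4 3 0 h.ne_y.symm (by decide) star_y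
  have z6 : cell w₁ a b c y 6 = 0 := cell_eq_zero_of_absent w₁ a b c y 6 1 0 h.ne_b.symm (by decide) star_b
  have z7 : cell w₁ a b c y 7 = 0 := cell_eq_zero_of_absent w₁ a b c y 7 1 2 hbc (by decide) star_b
  have z8 : cell w₁ a b c y 8 = 0 := cell_eq_zero_of_absent w₁ a b c y 8 1 2 hbc (by decide) star_b
  have z9 : cell w₁ a b c y 9 = 0 := cell_eq_zero_of_absent w₁ a b c y 9 1 3 hby (by decide) star_b
  have z10 : cell w₁ a b c y 10 = 0 := cell_eq_zero_of_absent w₁ a b c y 10 3 0 h.ne_y.symm (by decide) star_y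
  have z11 : cell w₁ a b c y 11 = 0 := cell_eq_zero_of_absent w₁ a b c y 11 1 0 h.ne_b.symm (by decide) star_b
  have z12 : cell w₁ a b c y 12 = 0 := cell_eq_zero_of_absent w₁ a b c y 12 1 0 h.ne_b.symm (by decide) star_b
  have z13 : cell w₁ a b c y 13 = 0 := cell_eq_zero_of_absent w₁ a b c y 13 1 0 h.ne_b.symm (by decide) star_b
  have z14 : cell w₁ a b c y 14 = 0 := cell_eq_zero_of_absent w₁ a b c y 14 1 0 h.ne_b.symm (by decide) star_b
  refine q44_cells_of_portSplit_core h ?_ ?_ ?_ ?_ <;> simp only [z1, z2, z3, z4, z6, z7, z8, z9, z10, z11, z12, z13, z14, mul_zero, zero_mul, add_zero, zero_add, sub_zero] <;>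
    norm_num

set_option linter.unusedSimpArgs false in
/-- **Conjecture W when the terminal `y` separates `a` from the other two terminals** (`b, c, y` distinct): if `S ∋ a` avoids `b, c, y` and every
pair of positive weight leaving `S` ends at `y`, then `w` satisfies Conjecture W: the side of `a` has the single port `y`, the other two terminals are
isolated there, its only cells are `0` and `4`, and all four CORE forms of the side vanish (`ConjWPort.q44_cells_of_portSplit_core`). [this work] -/
theorem q44_cells_of_cutTerminal_y (w : Sym2 (Fin n) → unitInterval) (a b c y : Fin n) (hbc : b ≠ c) (hby : b ≠ y) (hcy : c ≠ y)
    (S : Finset (Fin n)) (haS : a ∈ S) (hbS : b ∉ S) (hcS : c ∉ S) (hyS : y ∉ S)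
    (hS : ∀ u ∈ S, ∀ v, v ∉ S → v ≠ y → w s(u, v) = 0) :
    2 * (cell w a b c y 11 * cell w a b c y 9 + cell w a b c y 11 * cell w a b c y 8 + cell w a b c y 6 * cell w a b c y 8 +
        cell w a b c y 6 * cell w a b c y 1 + cell w a b c y 1 * cell w a b c y 8) +
        (cell w a b c y 2 * cell w a b c y 13 + cell w a b c y 1 * cell w a b c y 13 + cell w a b c y 5 * cell w a b c y 12 +
        cell w a b c y 1 * cell w a b c y 12 + cell w a b c y 6 * cell w a b c y 10 + cell w a b c y 6 * cell w a b c y 7 +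
          cell w a b c y 2 * cell w a b c y 10 + cell w a b c y 5 * cell w a b c y 7) ≤
      2 * ((cell w a b c y 11 + cell w a b c y 14) * cell w a b c y 0) := by
  set w₁ : Sym2 (Fin n) → unitInterval := fun e => if (∃ u ∈ S, u ∈ e) then w e else 0 with hw₁
  have h := IsPortSplit.of_side w a b c y S haS hbS hcS hyS (fun u hu v hv hvb hvc hvy => hS u hu v hv hvy)
    w₁ (fun e => if (∃ u ∈ S, u ∈ e) then 0 else w e) (fun _ => rfl) (fun _ => rfl)
  have star_b : ∀ u, u ≠ b → (w₁ s(b, u) : ℝ) = 0 := fun u _ => by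
    have hz : w₁ s(b, u) = 0 := by
      simp only [hw₁]
      split_ifs with hex
      · obtain ⟨u', hu'S, hu'e⟩ := hex
        rcases Sym2.mem_iff.1 hu'e with h' | h'
        · exact absurd hu'S (h' ▸ hbS)
        · subst h'
          rw [Sym2.eq_swap]
          exact hS u' hu'S b hbS hby
      · rfl
    rw [hz]; rfl
  have star_c : ∀ u, u ≠ c → (w₁ s(c, u) : ℝ) = 0 := fun u _ => by
    have hz : w₁ s(c, u) = 0 := by
      simp only [hw₁]
      split_ifs with hex
      · obtain ⟨u', hu'S, hu'e⟩ := hex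
        rcases Sym2.mem_iff.1 hu'e with h' | h'
        · exact absurd hu'S (h' ▸ hcS)
        · subst h'
          rw [Sym2.eq_swap]
          exact hS u' hu'S c hcS hcy
      · rfl
    rw [hz]; rfl
  have z1 : cell w₁ a b c y 1 = 0 := cell_eq_zero_of_absent w₁ a b c y 1 2 3 hcy (by decide) star_c
  have z2 : cell w₁ a b c y 2 = 0 := cell_eq_zero_of_absent w₁ a b c y 2 1 3 hby (by decide) star_b
  have z3 : cell w₁ a b c y 3 = 0 := cell_eq_zero_of_absent w₁ a b c y 3 1 2 hbc (by decide) star_b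
  have z5 : cell w₁ a b c y 5 = 0 := cell_eq_zero_of_absent w₁ a b c y 5 2 0 h.ne_c.symm (by decide) star_c
  have z6 : cell w₁ a b c y 6 = 0 := cell_eq_zero_of_absent w₁ a b c y 6 1 0 h.ne_b.symm (by decide) star_b
  have z7 : cell w₁ a b c y 7 = 0 := cell_eq_zero_of_absent w₁ a b c y 7 1 2 hbc (by decide) star_b
  have z8 : cell w₁ a b c y 8 = 0 := cell_eq_zero_of_absent w₁ a b c y 8 1 2 hbc (by decide) star_b
  have z9 : cell w₁ a b c y 9 = 0 := cell_eq_zero_of_absent w₁ a b c y 9 1 3 hby (by decide) star_b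
  have z10 : cell w₁ a b c y 10 = 0 := cell_eq_zero_of_absent w₁ a b c y 10 2 0 h.ne_c.symm (by decide) star_c
  have z11 : cell w₁ a b c y 11 = 0 := cell_eq_zero_of_absent w₁ a b c y 11 1 0 h.ne_b.symm (by decide) star_b
  have z12 : cell w₁ a b c y 12 = 0 := cell_eq_zero_of_absent w₁ a b c y 12 1 0 h.ne_b.symm (by decide) star_b
  have z13 : cell w₁ a b c y 13 = 0 := cell_eq_zero_of_absent w₁ a b c y 13 1 0 h.ne_b.symm (by decide) star_b
  have z14 : cell w₁ a b c y 14 = 0 := cell_eq_zero_of_absent w₁ a b c y 14 1 0 h.ne_b.symm (by decide) star_b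
  refine q44_cells_of_portSplit_core h ?_ ?_ ?_ ?_ <;> simp only [z1, z2, z3, z5, z6, z7, z8, z9, z10, z11, z12, z13, z14, mul_zero, zero_mul, add_zero, zero_add, sub_zero] <;>
    norm_num

end ConjWPort

end Summit.CriticalPhenomena.PercolationContinuityZ3.Theorems
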